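import Mathlib
import Summits.Ventures.PercRepro2.Defs
import Summits.Ventures.PercRepro2.Harris
import Summits.Ventures.PercRepro2.CoinDefs
import Summits.Ventures.PercRepro2.CoinLsmCoreDefs
import Summits.Ventures.PercRepro2.CoinLsmCoreU
import Summits.Ventures.PercRepro2.CoinCyl5
import Summits.Ventures.PercRepro2.CoinD21CoreDefs

/-!
# The sixteen core level probabilities of the two-route core `s → p → r → a ← q ← s` (blind cell
PercRepro2, night-2 g8; proofs/NIGHT2-DARC.md §33)

From the five-coin cylinder partition: the ten clusters `∅, p, q, qa, pq, pr, pqa, pra, pqr, pqra`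
carry the polynomials of `CoinD21CoreDefs.lean`; the six subsets `r, a, ra, pa, rq, rqa` have
probability `0`.
-/

namespace Summit.Ventures.PercRepro2.Coin

open Classical

section D21Levels

variable {V : Type*} {E : Type*} [DecidableEq V] [Fintype E] [DecidableEq E]
  {R : Type*} [Field R]
  {arcs : E → Finset (V × V)} {s p r q a : V} {c₁ c₂ c₃ c₄ c₅ : E}

omit [Fintype E] [DecidableEq E] in
/-- On the cylinder of `b`, membership in the core level of `W` is the Boolean condition. -/
lemma D21Core.level_inter_cyl (h : D21Core arcs s p r q a c₁ c₂ c₃ c₄ c₅) (W : Finset V)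
    (b : Bool × Bool × Bool × Bool × Bool) :
    coreLevel arcs s {p, r, q, a} W ∩
        {ω | ω c₁ = b.1 ∧ ω c₂ = b.2.1 ∧ ω c₃ = b.2.2.1 ∧ ω c₄ = b.2.2.2.1 ∧ ω c₅ = b.2.2.2.2}
      = if (p ∈ W ↔ b.1 = true) ∧ (r ∈ W ↔ (b.1 = true ∧ b.2.1 = true)) ∧ (q ∈ W ↔ b.2.2.1 = true) ∧
          (a ∈ W ↔ ((b.1 = true ∧ b.2.1 = true ∧ b.2.2.2.1 = true) ∨
            (b.2.2.1 = true ∧ b.2.2.2.2 = true)))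
        then {ω | ω c₁ = b.1 ∧ ω c₂ = b.2.1 ∧ ω c₃ = b.2.2.1 ∧ ω c₄ = b.2.2.2.1 ∧ ω c₅ = b.2.2.2.2}
        else ∅ := by
  obtain ⟨b₁, b₂, b₃, b₄, b₅⟩ := b
  ext ω
  have hmem : ω ∈ coreLevel arcs s {p, r, q, a} W ↔
      (p ∈ W ↔ ω c₁ = true) ∧ (r ∈ W ↔ (ω c₁ = true ∧ ω c₂ = true)) ∧ (q ∈ W ↔ ω c₃ = true) ∧
        (a ∈ W ↔ ((ω c₁ = true ∧ ω c₂ = true ∧ ω c₄ = true) ∨ (ω c₃ = true ∧ ω c₅ = true))) := by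
    rw [mem_coreLevel]
    simp only [Finset.mem_insert, Finset.mem_singleton, forall_eq_or_imp, forall_eq,
      h.reach_p_iff, h.reach_r_iff, h.reach_q_iff, h.reach_a_iff]
  simp only [Set.mem_inter_iff, hmem, Set.mem_setOf_eq]
  split_ifs with hc
  · simp only [Set.mem_setOf_eq]
    constructor
    · rintro ⟨_, hω⟩; exact hω
    · rintro ⟨h1, h2, h3, h4, h5⟩
      refine ⟨?_, h1, h2, h3, h4, h5⟩
      rw [h1, h2, h3, h4, h5]; exact hc
  · simp only [Set.mem_empty_iff_false, iff_false]
    rintro ⟨hW, h1, h2, h3, h4, h5⟩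
    rw [h1, h2, h3, h4, h5] at hW
    exact hc hW

/-- The core level probabilities as a sum over the `32` coin configurations. -/
theorem D21Core.prob_level (h : D21Core arcs s p r q a c₁ c₂ c₃ c₄ c₅) (pr : E → R)
    (h12 : c₁ ≠ c₂) (h13 : c₁ ≠ c₃) (h14 : c₁ ≠ c₄) (h15 : c₁ ≠ c₅) (h23 : c₂ ≠ c₃) (h24 : c₂ ≠ c₄)
    (h25 : c₂ ≠ c₅) (h34 : c₃ ≠ c₄) (h35 : c₃ ≠ c₅) (h45 : c₄ ≠ c₅) (W : Finset V) :
    prob pr (coreLevel arcs s {p, r, q, a} W) = ∑ b : Bool × Bool × Bool × Bool × Bool,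
      if (p ∈ W ↔ b.1 = true) ∧ (r ∈ W ↔ (b.1 = true ∧ b.2.1 = true)) ∧ (q ∈ W ↔ b.2.2.1 = true) ∧
          (a ∈ W ↔ ((b.1 = true ∧ b.2.1 = true ∧ b.2.2.2.1 = true) ∨
            (b.2.2.1 = true ∧ b.2.2.2.2 = true)))
        then edgeFactor (pr c₁) b.1 * edgeFactor (pr c₂) b.2.1 * edgeFactor (pr c₃) b.2.2.1 *
          edgeFactor (pr c₄) b.2.2.2.1 * edgeFactor (pr c₅) b.2.2.2.2 else 0 := by
  rw [prob_eq_sum_cyl5 (c₁ := c₁) (c₂ := c₂) (c₃ := c₃) (c₄ := c₄) (c₅ := c₅)]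
  refine Finset.sum_congr rfl fun b _ => ?_
  rw [h.level_inter_cyl W b]
  split_ifs
  · exact prob_cyl5 pr h12 h13 h14 h15 h23 h24 h25 h34 h35 h45 b
  · simp [prob]

/-- `ν(∅) = (1 - pr c₁) * (1 - pr c₃)`. -/
theorem D21Core.nu_empty (h : D21Core arcs s p r q a c₁ c₂ c₃ c₄ c₅) (pr : E → R)
    (h12 : c₁ ≠ c₂) (h13 : c₁ ≠ c₃) (h14 : c₁ ≠ c₄) (h15 : c₁ ≠ c₅) (h23 : c₂ ≠ c₃) (h24 : c₂ ≠ c₄)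
    (h25 : c₂ ≠ c₅) (h34 : c₃ ≠ c₄) (h35 : c₃ ≠ c₅) (h45 : c₄ ≠ c₅) :
    prob pr (coreLevel arcs s {p, r, q, a} ∅) = (1 - pr c₁) * (1 - pr c₃) := by
  rw [h.prob_level pr h12 h13 h14 h15 h23 h24 h25 h34 h35 h45]
  simp [Fintype.sum_prod_type]
  ring

/-- `ν({p}) = pr c₁ * (1 - pr c₂) * (1 - pr c₃)`. -/
theorem D21Core.nu_p (h : D21Core arcs s p r q a c₁ c₂ c₃ c₄ c₅) (pr : E → R)
    (h12 : c₁ ≠ c₂) (h13 : c₁ ≠ c₃) (h14 : c₁ ≠ c₄) (h15 : c₁ ≠ c₅) (h23 : c₂ ≠ c₃) (h24 : c₂ ≠ c₄)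
    (h25 : c₂ ≠ c₅) (h34 : c₃ ≠ c₄) (h35 : c₃ ≠ c₅) (h45 : c₄ ≠ c₅) :
    prob pr (coreLevel arcs s {p, r, q, a} {p}) = pr c₁ * (1 - pr c₂) * (1 - pr c₃) := by
  rw [h.prob_level pr h12 h13 h14 h15 h23 h24 h25 h34 h35 h45]
  simp [Fintype.sum_prod_type, h.pr.symm, h.pq.symm, h.pa.symm]
  ring

/-- `ν({q}) = (1 - pr c₁) * pr c₃ * (1 - pr c₅)`. -/
theorem D21Core.nu_q (h : D21Core arcs s p r q a c₁ c₂ c₃ c₄ c₅) (pr : E → R)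
    (h12 : c₁ ≠ c₂) (h13 : c₁ ≠ c₃) (h14 : c₁ ≠ c₄) (h15 : c₁ ≠ c₅) (h23 : c₂ ≠ c₃) (h24 : c₂ ≠ c₄)
    (h25 : c₂ ≠ c₅) (h34 : c₃ ≠ c₄) (h35 : c₃ ≠ c₅) (h45 : c₄ ≠ c₅) :
    prob pr (coreLevel arcs s {p, r, q, a} {q}) = (1 - pr c₁) * pr c₃ * (1 - pr c₅) := by
  rw [h.prob_level pr h12 h13 h14 h15 h23 h24 h25 h34 h35 h45]
  simp [Fintype.sum_prod_type, h.pq, h.rq, h.qa.symm]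
  ring

/-- `ν({q, a}) = (1 - pr c₁) * pr c₃ * pr c₅`. -/
theorem D21Core.nu_qa (h : D21Core arcs s p r q a c₁ c₂ c₃ c₄ c₅) (pr : E → R)
    (h12 : c₁ ≠ c₂) (h13 : c₁ ≠ c₃) (h14 : c₁ ≠ c₄) (h15 : c₁ ≠ c₅) (h23 : c₂ ≠ c₃) (h24 : c₂ ≠ c₄)
    (h25 : c₂ ≠ c₅) (h34 : c₃ ≠ c₄) (h35 : c₃ ≠ c₅) (h45 : c₄ ≠ c₅) :
    prob pr (coreLevel arcs s {p, r, q, a} {q, a}) = (1 - pr c₁) * pr c₃ * pr c₅ := by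
  rw [h.prob_level pr h12 h13 h14 h15 h23 h24 h25 h34 h35 h45]
  simp [Fintype.sum_prod_type, h.pq, h.rq, h.pa, h.ra]
  ring

/-- `ν({p, q}) = pr c₁ * (1 - pr c₂) * pr c₃ * (1 - pr c₅)`. -/
theorem D21Core.nu_pq (h : D21Core arcs s p r q a c₁ c₂ c₃ c₄ c₅) (pr : E → R)
    (h12 : c₁ ≠ c₂) (h13 : c₁ ≠ c₃) (h14 : c₁ ≠ c₄) (h15 : c₁ ≠ c₅) (h23 : c₂ ≠ c₃) (h24 : c₂ ≠ c₄)
    (h25 : c₂ ≠ c₅) (h34 : c₃ ≠ c₄) (h35 : c₃ ≠ c₅) (h45 : c₄ ≠ c₅) :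
    prob pr (coreLevel arcs s {p, r, q, a} {p, q}) = pr c₁ * (1 - pr c₂) * pr c₃ * (1 - pr c₅) := by
  rw [h.prob_level pr h12 h13 h14 h15 h23 h24 h25 h34 h35 h45]
  simp [Fintype.sum_prod_type, h.pr.symm, h.rq, h.pa.symm, h.qa.symm]
  ring

/-- `ν({p, r}) = pr c₁ * pr c₂ * (1 - pr c₃) * (1 - pr c₄)`. -/
theorem D21Core.nu_pr (h : D21Core arcs s p r q a c₁ c₂ c₃ c₄ c₅) (pr : E → R)
    (h12 : c₁ ≠ c₂) (h13 : c₁ ≠ c₃) (h14 : c₁ ≠ c₄) (h15 : c₁ ≠ c₅) (h23 : c₂ ≠ c₃) (h24 : c₂ ≠ c₄)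
    (h25 : c₂ ≠ c₅) (h34 : c₃ ≠ c₄) (h35 : c₃ ≠ c₅) (h45 : c₄ ≠ c₅) :
    prob pr (coreLevel arcs s {p, r, q, a} {p, r}) = pr c₁ * pr c₂ * (1 - pr c₃) * (1 - pr c₄) := by
  rw [h.prob_level pr h12 h13 h14 h15 h23 h24 h25 h34 h35 h45]
  simp [Fintype.sum_prod_type, h.pq.symm, h.rq.symm, h.pa.symm, h.ra.symm]
  ring

/-- `ν({p, q, a}) = pr c₁ * (1 - pr c₂) * pr c₃ * pr c₅`. -/
theorem D21Core.nu_pqa (h : D21Core arcs s p r q a c₁ c₂ c₃ c₄ c₅) (pr : E → R)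
    (h12 : c₁ ≠ c₂) (h13 : c₁ ≠ c₃) (h14 : c₁ ≠ c₄) (h15 : c₁ ≠ c₅) (h23 : c₂ ≠ c₃) (h24 : c₂ ≠ c₄)
    (h25 : c₂ ≠ c₅) (h34 : c₃ ≠ c₄) (h35 : c₃ ≠ c₅) (h45 : c₄ ≠ c₅) :
    prob pr (coreLevel arcs s {p, r, q, a} {p, q, a}) = pr c₁ * (1 - pr c₂) * pr c₃ * pr c₅ := by
  rw [h.prob_level pr h12 h13 h14 h15 h23 h24 h25 h34 h35 h45]
  simp [Fintype.sum_prod_type, h.pr.symm, h.rq, h.ra]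
  ring

/-- `ν({p, r, a}) = pr c₁ * pr c₂ * (1 - pr c₃) * pr c₄`. -/
theorem D21Core.nu_pra (h : D21Core arcs s p r q a c₁ c₂ c₃ c₄ c₅) (pr : E → R)
    (h12 : c₁ ≠ c₂) (h13 : c₁ ≠ c₃) (h14 : c₁ ≠ c₄) (h15 : c₁ ≠ c₅) (h23 : c₂ ≠ c₃) (h24 : c₂ ≠ c₄)
    (h25 : c₂ ≠ c₅) (h34 : c₃ ≠ c₄) (h35 : c₃ ≠ c₅) (h45 : c₄ ≠ c₅) :
    prob pr (coreLevel arcs s {p, r, q, a} {p, r, a}) = pr c₁ * pr c₂ * (1 - pr c₃) * pr c₄ := by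
  rw [h.prob_level pr h12 h13 h14 h15 h23 h24 h25 h34 h35 h45]
  simp [Fintype.sum_prod_type, h.pq.symm, h.rq.symm, h.qa]
  ring

/-- `ν({p, r, q}) = pr c₁ * pr c₂ * pr c₃ * (1 - pr c₄) * (1 - pr c₅)`. -/
theorem D21Core.nu_pqr (h : D21Core arcs s p r q a c₁ c₂ c₃ c₄ c₅) (pr : E → R)
    (h12 : c₁ ≠ c₂) (h13 : c₁ ≠ c₃) (h14 : c₁ ≠ c₄) (h15 : c₁ ≠ c₅) (h23 : c₂ ≠ c₃) (h24 : c₂ ≠ c₄)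
    (h25 : c₂ ≠ c₅) (h34 : c₃ ≠ c₄) (h35 : c₃ ≠ c₅) (h45 : c₄ ≠ c₅) :
    prob pr (coreLevel arcs s {p, r, q, a} {p, r, q}) = pr c₁ * pr c₂ * pr c₃ * (1 - pr c₄) * (1 - pr c₅) := by
  rw [h.prob_level pr h12 h13 h14 h15 h23 h24 h25 h34 h35 h45]
  simp [Fintype.sum_prod_type, h.pa.symm, h.ra.symm, h.qa.symm]

/-- `ν({p, r, q, a}) = pr c₁ * pr c₂ * pr c₃ * (pr c₄ + pr c₅ - pr c₄ * pr c₅)`. -/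
theorem D21Core.nu_pqra (h : D21Core arcs s p r q a c₁ c₂ c₃ c₄ c₅) (pr : E → R)
    (h12 : c₁ ≠ c₂) (h13 : c₁ ≠ c₃) (h14 : c₁ ≠ c₄) (h15 : c₁ ≠ c₅) (h23 : c₂ ≠ c₃) (h24 : c₂ ≠ c₄)
    (h25 : c₂ ≠ c₅) (h34 : c₃ ≠ c₄) (h35 : c₃ ≠ c₅) (h45 : c₄ ≠ c₅) :
    prob pr (coreLevel arcs s {p, r, q, a} {p, r, q, a}) = pr c₁ * pr c₂ * pr c₃ * (pr c₄ + pr c₅ - pr c₄ * pr c₅) := by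
  rw [h.prob_level pr h12 h13 h14 h15 h23 h24 h25 h34 h35 h45]
  simp [Fintype.sum_prod_type, h.qa]
  ring

/-- `ν({r}) = 0`. -/
theorem D21Core.nu_r (h : D21Core arcs s p r q a c₁ c₂ c₃ c₄ c₅) (pr : E → R)
    (h12 : c₁ ≠ c₂) (h13 : c₁ ≠ c₃) (h14 : c₁ ≠ c₄) (h15 : c₁ ≠ c₅) (h23 : c₂ ≠ c₃) (h24 : c₂ ≠ c₄)
    (h25 : c₂ ≠ c₅) (h34 : c₃ ≠ c₄) (h35 : c₃ ≠ c₅) (h45 : c₄ ≠ c₅) :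
    prob pr (coreLevel arcs s {p, r, q, a} {r}) = 0 := by
  rw [h.prob_level pr h12 h13 h14 h15 h23 h24 h25 h34 h35 h45]
  simp [Fintype.sum_prod_type, h.pr, h.rq.symm, h.ra.symm]

/-- `ν({a}) = 0`. -/
theorem D21Core.nu_a (h : D21Core arcs s p r q a c₁ c₂ c₃ c₄ c₅) (pr : E → R)
    (h12 : c₁ ≠ c₂) (h13 : c₁ ≠ c₃) (h14 : c₁ ≠ c₄) (h15 : c₁ ≠ c₅) (h23 : c₂ ≠ c₃) (h24 : c₂ ≠ c₄)
    (h25 : c₂ ≠ c₅) (h34 : c₃ ≠ c₄) (h35 : c₃ ≠ c₅) (h45 : c₄ ≠ c₅) :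
    prob pr (coreLevel arcs s {p, r, q, a} {a}) = 0 := by
  rw [h.prob_level pr h12 h13 h14 h15 h23 h24 h25 h34 h35 h45]
  simp [Fintype.sum_prod_type, h.pa, h.ra, h.qa]

/-- `ν({r, a}) = 0`. -/
theorem D21Core.nu_ra (h : D21Core arcs s p r q a c₁ c₂ c₃ c₄ c₅) (pr : E → R)
    (h12 : c₁ ≠ c₂) (h13 : c₁ ≠ c₃) (h14 : c₁ ≠ c₄) (h15 : c₁ ≠ c₅) (h23 : c₂ ≠ c₃) (h24 : c₂ ≠ c₄)
    (h25 : c₂ ≠ c₅) (h34 : c₃ ≠ c₄) (h35 : c₃ ≠ c₅) (h45 : c₄ ≠ c₅) :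
    prob pr (coreLevel arcs s {p, r, q, a} {r, a}) = 0 := by
  rw [h.prob_level pr h12 h13 h14 h15 h23 h24 h25 h34 h35 h45]
  simp [Fintype.sum_prod_type, h.pr, h.pa, h.rq.symm, h.qa]

/-- `ν({p, a}) = 0`. -/
theorem D21Core.nu_pa (h : D21Core arcs s p r q a c₁ c₂ c₃ c₄ c₅) (pr : E → R)
    (h12 : c₁ ≠ c₂) (h13 : c₁ ≠ c₃) (h14 : c₁ ≠ c₄) (h15 : c₁ ≠ c₅) (h23 : c₂ ≠ c₃) (h24 : c₂ ≠ c₄)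
    (h25 : c₂ ≠ c₅) (h34 : c₃ ≠ c₄) (h35 : c₃ ≠ c₅) (h45 : c₄ ≠ c₅) :
    prob pr (coreLevel arcs s {p, r, q, a} {p, a}) = 0 := by
  rw [h.prob_level pr h12 h13 h14 h15 h23 h24 h25 h34 h35 h45]
  simp [Fintype.sum_prod_type, h.pr.symm, h.ra, h.pq.symm, h.qa]

/-- `ν({r, q}) = 0`. -/
theorem D21Core.nu_rq (h : D21Core arcs s p r q a c₁ c₂ c₃ c₄ c₅) (pr : E → R)
    (h12 : c₁ ≠ c₂) (h13 : c₁ ≠ c₃) (h14 : c₁ ≠ c₄) (h15 : c₁ ≠ c₅) (h23 : c₂ ≠ c₃) (h24 : c₂ ≠ c₄)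
    (h25 : c₂ ≠ c₅) (h34 : c₃ ≠ c₄) (h35 : c₃ ≠ c₅) (h45 : c₄ ≠ c₅) :
    prob pr (coreLevel arcs s {p, r, q, a} {r, q}) = 0 := by
  rw [h.prob_level pr h12 h13 h14 h15 h23 h24 h25 h34 h35 h45]
  simp [Fintype.sum_prod_type, h.pr, h.pq, h.ra.symm, h.qa.symm]

/-- `ν({r, q, a}) = 0`. -/
theorem D21Core.nu_rqa (h : D21Core arcs s p r q a c₁ c₂ c₃ c₄ c₅) (pr : E → R)
    (h12 : c₁ ≠ c₂) (h13 : c₁ ≠ c₃) (h14 : c₁ ≠ c₄) (h15 : c₁ ≠ c₅) (h23 : c₂ ≠ c₃) (h24 : c₂ ≠ c₄)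
    (h25 : c₂ ≠ c₅) (h34 : c₃ ≠ c₄) (h35 : c₃ ≠ c₅) (h45 : c₄ ≠ c₅) :
    prob pr (coreLevel arcs s {p, r, q, a} {r, q, a}) = 0 := by
  rw [h.prob_level pr h12 h13 h14 h15 h23 h24 h25 h34 h35 h45]
  simp [Fintype.sum_prod_type, h.pr, h.pq, h.pa]

end D21Levels

end Summit.Ventures.PercRepro2.Coin
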